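import Literature.NumberTheory.IwasawaTheory.ClassicalMuVanishesSplitCartanFiveDescent
import Literature.NumberTheory.IwasawaTheory.ClassicalMuVanishesIffBoundedRank
import HarnessLib

set_option autoImplicit false

/-!
# Ferrero–Washington-FREE steps for the `N_s(5) = (C₄ × C₄) ⋊ C₂` μ-descent: the abelian leaves made explicit

Topic `NumberTheory/IwasawaTheory` (namespace = path).  THEOREM-ONLY file (no definition, no named fact, no `sorry`); prover seat
`bsd-potss-k8t-c4` g24 (cell `bsd-potss`; supports the KT U₀ node stmt-BirchSwinnertonDyer-19982 / the Conj-A residue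
stmt-BirchSwinnertonDyer-19916 on the `5Ns` rows; closes nothing).

`ClassicalMuVanishesSplitCartanFiveDescent` (conjA-anchor g11) proves «`μ = 0` for the cyclotomic `ℤ_p`-tower of `L`» for
`Gal(L/ℚ) ⊇ ⟨u, v, w⟩` with the relations of `N_s(5)` from FOUR non-abelian leaves `L^{⟨v⟩}`, `L^{⟨u²v⟩}`, `L^{⟨u²,v⟩}`, `L^{⟨uv,w⟩}`
modulo Ferrero–Washington, which supplied `μ = 0` for every subfield of the maximal abelian subfield `A = L^{⟨uv⁻¹⟩}` (`⟨uv⁻¹⟩ ⊇ [G,G]`;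
for `L = ℚ(E[5])` with image `C_s⁺(5)`: `A = ℚ(ζ₅, √d₁)`, `Gal(A/ℚ) ≅ C₄ × C₂`).  CHARACTER COUNT: of the `8` linear characters of `N_s(5)`
only `1`, `sgn_{C_s}` and `χ_{√5}` are visible in those four leaves; the other five are the two faithful characters of the cyclic quartic
`K′ = L^{⟨uv⁻¹, w⟩}` (`⊇ ℚ(√5)`), the two of `Z = L^{⟨uv⁻¹, u²w⟩}` (`= L^{ker det} = ℚ(ζ₅)`) and the character of the quadratic
`Q₂ = L^{⟨uv⁻¹, wu⟩}` (`= ℚ(√(5 d₁))`).  This file supplies the two ABELIAN Kuroda steps with exactly these three fields as inputs: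

* §1 `classicalMuVanishes_of_isCyclotomic_of_kuroda_conj` — the `D₄`-shape Kuroda step with the `z`-leaf an INPUT (FW-free twin of
  `classicalMuVanishes_of_isCyclotomic_of_kuroda_rat`);
* §2 `classicalMuVanishes_of_isCyclotomic_fixedField_comm_sup_sq` — `B = L^{⟨uv⁻¹, u²⟩}` (`= ℚ(√5, √d₁)`) from `L^{⟨v⟩} ⊇ Q₁`, `K′ ⊇ ℚ(√5)`,
  `Q₂` (Klein four `{1, w̄, ū, w̄ū}` of `Gal(B/ℚ)`);
* §3 `classicalMuVanishes_of_isCyclotomic_fixedField_comm` — `A = L^{⟨uv⁻¹⟩}` from `B`, `K′`, `Z` (Klein four `{1, ū², w̄, ū²w̄}` of `Gal(A/ℚ)`).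

All steps are Kuroda EQUALITIES at every layer (`classicalMuVanishes_of_isCyclotomic_of_biquadratic`) and `p`-prime-index descents
(`classicalMuVanishes_of_isCyclotomic_of_tower'`); no growth theorem, no named fact.

References: [Lemmermeyer1994, §1 (Kuroda's class number formula, odd part)]; [Washington1997, §7.5, §13.1]; [MilneFT2022, Ch. 3];
[Serre1972, §2.2 (split Cartan subgroups and their normalisers)]; [BiasseEtAl2022, Example 2.5, Prop. 3.7 (norm relations)].
-/

noncomputable section

open scoped NumberField

open Field IntermediateField Literature.NumberTheory.EllipticCurves

namespace Literature.NumberTheory.IwasawaTheory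

variable {p : ℕ} [Fact p.Prime]

/-! ### §0 Transport helpers (fixed fields of `L/ℚ`) -/

omit [Fact p.Prime] in
/-- `p ∤ [E : ℚ]` for an intermediate field `E` of `L/ℚ` when `p ∤ [L : ℚ]` (tower law). [cite: MilneFT2022, Ch. 3 (tower law, fundamental theorem)] -/
theorem not_dvd_finrank_intermediateField_rat {L : Type} [Field L] [NumberField L]
    (hp : ¬ p ∣ Module.finrank ℚ L) (E : IntermediateField ℚ L) : ¬ p ∣ Module.finrank ℚ ↥E := fun h =>
  hp (h.trans (Dvd.intro _ (Module.finrank_mul_finrank ℚ ↥E L)))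

omit [Fact p.Prime] in
/-- For `N ⊴ Gal(L/F)`, `N ≤ H`, `M = L^N`: `M^{H̄} ≃ₐ[F] L^H` (`H̄` the image of `H` in `Gal(M/F)`).
[cite: MilneFT2022, Ch. 3 (fundamental theorem of Galois theory)] -/
theorem nonempty_algEquiv_fixedField_map_restrictNormalHom {F L : Type} [Field F] [Field L] [Algebra F L]
    [FiniteDimensional F L] [IsGalois F L] (N H : Subgroup (L ≃ₐ[F] L)) [N.Normal] (hNH : N ≤ H)
    (H' : Subgroup (↥(fixedField N) ≃ₐ[F] ↥(fixedField N)))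
    (hH' : H.map (AlgEquiv.restrictNormalHom ↥(fixedField N)) = H') :
    Nonempty (↥(fixedField H') ≃ₐ[F] ↥(fixedField H)) := by
  have h1 := InfiniteGalois.restrict_fixedField H (fixedField N)
  rw [hH'] at h1
  have h2 : IntermediateField.lift (fixedField H') = fixedField H := by
    rw [← h1]
    exact inf_eq_left.mpr (IntermediateField.fixedField_le hNH)
  exact ⟨(IntermediateField.liftAlgEquiv (fixedField H')).trans (IntermediateField.equivOfEq h2)⟩

omit [Fact p.Prime] in
/-- A subgroup containing all commutators is normal (it is the preimage of a subgroup of the abelianisation). [cite: DummitFoote2004, §5.4 Prop. 7] -/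
theorem normal_of_forall_commutator_mem {G : Type} [Group G] (S : Subgroup G) (h : ∀ a c : G, a * c * a⁻¹ * c⁻¹ ∈ S) :
    S.Normal := by
  refine ⟨fun k hk a => ?_⟩
  have h2 : a * k * a⁻¹ = (a * k * a⁻¹ * k⁻¹) * k := by group
  rw [h2]
  exact S.mul_mem (h a k) hk

/-- **`p`-prime-index descent between fixed fields**: `S ≤ T` (so `L^T ⊆ L^S`) and «`μ = 0` for every cyclotomic `ℤ_p`-extension of
`L^S`» give the same for `L^T` (`p ∤ [L : ℚ]`). [cite: Washington1997, §13.1] -/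
theorem forall_classicalMuVanishes_fixedField_of_le {L : Type} [Field L] [NumberField L]
    (hp : ¬ p ∣ Module.finrank ℚ L) {S T : Subgroup (L ≃ₐ[ℚ] L)} (hST : S ≤ T)
    (h : ∀ κE : ZpExtension ↥(fixedField S) p, κE.IsCyclotomic → ClassicalMuVanishes κE) :
    ∀ κE : ZpExtension ↥(fixedField T) p, κE.IsCyclotomic → ClassicalMuVanishes κE := by
  obtain ⟨κ, hκ⟩ := exists_cyclotomicZpExtension_holds ℚ p
  have hle : fixedField T ≤ fixedField S := IntermediateField.fixedField_le hST
  letI : Algebra ↥(fixedField T) ↥(fixedField S) := (IntermediateField.inclusion hle).toRingHom.toAlgebra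
  haveI : IsScalarTower ℚ ↥(fixedField T) ↥(fixedField S) := IsScalarTower.of_algebraMap_eq fun _ => rfl
  exact classicalMuVanishes_of_isCyclotomic_of_tower' κ hκ ↥(fixedField T) ↥(fixedField S)
    (not_dvd_finrank_intermediateField_rat hp _) h

/-- Transport of «`μ = 0` for every cyclotomic `ℤ_p`-extension» between fixed fields of EQUAL subgroups. [cite: Washington1997, §13.1] -/
theorem forall_classicalMuVanishes_fixedField_of_eq {L : Type} [Field L] [NumberField L]
    (hp : ¬ p ∣ Module.finrank ℚ L) {S T : Subgroup (L ≃ₐ[ℚ] L)} (hST : S = T)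
    (h : ∀ κE : ZpExtension ↥(fixedField S) p, κE.IsCyclotomic → ClassicalMuVanishes κE) :
    ∀ κE : ZpExtension ↥(fixedField T) p, κE.IsCyclotomic → ClassicalMuVanishes κE :=
  forall_classicalMuVanishes_fixedField_of_le hp hST.le h

/-- Transport along conjugation: `L^{g S g⁻¹} = g(L^S)` from `L^S` (conjugate fields have isomorphic class groups layer by layer). [cite: MilneFT2022, Ch. 3 (fundamental theorem: conjugate subgroups ↔ conjugate fields)] [cite: Washington1997, §13.1] -/
theorem forall_classicalMuVanishes_fixedField_of_conj {L : Type} [Field L] [NumberField L]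
    (hp : ¬ p ∣ Module.finrank ℚ L) (S T : Subgroup (L ≃ₐ[ℚ] L)) (g : L ≃ₐ[ℚ] L)
    (hST : S.map (MulAut.conj g).toMonoidHom = T)
    (h : ∀ κE : ZpExtension ↥(fixedField S) p, κE.IsCyclotomic → ClassicalMuVanishes κE) :
    ∀ κE : ZpExtension ↥(fixedField T) p, κE.IsCyclotomic → ClassicalMuVanishes κE := by
  haveI : FiniteDimensional ℚ L := inferInstance
  obtain ⟨φ⟩ := nonempty_algEquiv_fixedField_conj (F := ℚ) S g
  exact forall_classicalMuVanishes_of_algEquiv (F := ℚ) (φ.trans (IntermediateField.equivOfEq (congrArg fixedField hST)))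
    (not_dvd_finrank_intermediateField_rat hp _) h

/-- Transport to a quotient: for `N ⊴ G`, `N ≤ S`, `μ`-input for `L^S` gives `μ`-input for `(L^N)^{S̄}` (`≅ L^S`).
[cite: MilneFT2022, Ch. 3 (fundamental theorem of Galois theory)] [cite: Washington1997, §13.1] -/
theorem forall_classicalMuVanishes_fixedField_quotient {L : Type} [Field L] [NumberField L] [IsGalois ℚ L]
    (hp : ¬ p ∣ Module.finrank ℚ L) (N S : Subgroup (L ≃ₐ[ℚ] L)) [N.Normal] [IsGalois ℚ ↥(fixedField N)] (hNS : N ≤ S)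
    (π : (L ≃ₐ[ℚ] L) →* (↥(fixedField N) ≃ₐ[ℚ] ↥(fixedField N))) (hπ : π = AlgEquiv.restrictNormalHom ↥(fixedField N))
    (S' : Subgroup (↥(fixedField N) ≃ₐ[ℚ] ↥(fixedField N))) (hS' : S.map π = S')
    (h : ∀ κE : ZpExtension ↥(fixedField S) p, κE.IsCyclotomic → ClassicalMuVanishes κE) :
    ∀ κE : ZpExtension ↥(fixedField S') p, κE.IsCyclotomic → ClassicalMuVanishes κE := by
  subst hπ
  obtain ⟨e⟩ := nonempty_algEquiv_fixedField_map_restrictNormalHom N S hNS S' hS'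
  exact forall_classicalMuVanishes_of_algEquiv (F := ℚ) e.symm (not_dvd_finrank_intermediateField_rat hp _) h

/-! ### §1 The `D₄`-shape Kuroda step with the `z`-leaf an input (Ferrero–Washington-free) -/

/-- **Kuroda step, `z`-leaf displayed.**  `L/ℚ` finite Galois, `p` odd, `p ∤ [L:ℚ]`; `z, b ∈ Gal(L/ℚ)` commuting involutions with
`z b = g b g⁻¹` for some `g` (so `L^{⟨zb⟩} ≅ L^{⟨b⟩}`).  If `μ = 0` holds for every cyclotomic `ℤ_p`-extension of `L^{⟨z⟩}` AND of
`L^{⟨b⟩}`, then for every cyclotomic `ℤ_p`-extension of `L` — Kuroda's relation for `{1, z, b, zb}` at every layer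
(`classicalMuVanishes_of_isCyclotomic_of_biquadratic`; the fourth support `L^{⟨z,b⟩} ⊆ L^{⟨z⟩}` by `p`-prime-index descent).  The
FW-free twin of `classicalMuVanishes_of_isCyclotomic_of_kuroda_rat` (there `L^{⟨z⟩}`, `L^{⟨z,b⟩}` are abelian over `ℚ` and taken from
Ferrero–Washington). [cite: Lemmermeyer1994, §1 (Kuroda's class number formula, odd part)] [cite: Washington1997, §13.1] -/
theorem classicalMuVanishes_of_isCyclotomic_of_kuroda_conj (hp2 : p ≠ 2) (L : Type) [Field L] [NumberField L] [IsGalois ℚ L]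
    (hp : ¬ p ∣ Module.finrank ℚ L) {z b : L ≃ₐ[ℚ] L} (hz : z * z = 1) (hb : b * b = 1) (hzb : z * b = b * z)
    (hconj : ∃ g : L ≃ₐ[ℚ] L, g * b * g⁻¹ = z * b)
    (hμz : ∀ κE : ZpExtension ↥(fixedField (Subgroup.zpowers z)) p, κE.IsCyclotomic → ClassicalMuVanishes κE)
    (hμb : ∀ κE : ZpExtension ↥(fixedField (Subgroup.zpowers b)) p, κE.IsCyclotomic → ClassicalMuVanishes κE)
    (κL : ZpExtension L p) (hκL : κL.IsCyclotomic) : ClassicalMuVanishes κL := by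
  obtain ⟨g, hg⟩ := hconj
  have hmap : (Subgroup.zpowers b).map (MulAut.conj g).toMonoidHom = Subgroup.zpowers (z * b) := by
    rw [MonoidHom.map_zpowers]
    exact congrArg Subgroup.zpowers hg
  have hμzb : ∀ κE : ZpExtension ↥(fixedField (Subgroup.zpowers (z * b))) p, κE.IsCyclotomic → ClassicalMuVanishes κE :=
    forall_classicalMuVanishes_fixedField_of_conj hp _ _ g hmap hμb
  have hle : Subgroup.zpowers z ≤ Subgroup.closure ({z, b} : Set (L ≃ₐ[ℚ] L)) := by
    rw [Subgroup.zpowers_le]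
    exact Subgroup.subset_closure (Set.mem_insert z {b})
  exact classicalMuVanishes_of_isCyclotomic_of_biquadratic hp2 L hp hz hb hzb hμz hμb hμzb
    (forall_classicalMuVanishes_fixedField_of_le hp hle hμz) κL hκL

/-! ### §2 The biquadratic leaf `B = L^{⟨uv⁻¹, u²⟩}` from `L^{⟨v⟩}`, `K′ = L^{⟨uv⁻¹, w⟩}`, `Q₂ = L^{⟨uv⁻¹, wu⟩}` -/

set_option maxHeartbeats 800000 in
/-- **Step (B): `B = L^{⟨uv⁻¹, u²⟩}` (`= ℚ(√5, √d₁)` for `L = ℚ(E[5])`).**  `L/ℚ` finite Galois, `p` odd, `p ∤ [L:ℚ]`;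
`u, v, w ∈ Gal(L/ℚ)` with `w² = 1` and all commutators in `⟨uv⁻¹⟩`.  `N = ⟨uv⁻¹, u²⟩` is normal and
`Gal(L^N/ℚ) ⊇ {1, w̄, ū, w̄ū}` is a Klein four whose supports are `L^{N⟨w⟩} ⊆ K′ = L^{⟨uv⁻¹, w⟩}`, `L^{N⟨u⟩} ⊆ L^{⟨v⟩}`
(`v = (uv⁻¹)⁻¹ u`), `L^{N⟨wu⟩} ⊆ Q₂ = L^{⟨uv⁻¹, wu⟩}` and `L^{N⟨w,u⟩} ⊆ K′`; Kuroda's equality at every layer.  NO named fact.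
[cite: Lemmermeyer1994, §1 (Kuroda's class number formula, odd part)] [cite: Washington1997, §13.1] [cite: MilneFT2022, Ch. 3]
[cite: Serre1972, §2.2 (split Cartan subgroups, normalisers)] -/
theorem classicalMuVanishes_of_isCyclotomic_fixedField_comm_sup_sq (hp2 : p ≠ 2) (L : Type) [Field L] [NumberField L]
    [IsGalois ℚ L] (hp : ¬ p ∣ Module.finrank ℚ L) {u v w : L ≃ₐ[ℚ] L} (hw2 : w * w = 1)
    (hcomm : ∀ a c : L ≃ₐ[ℚ] L, a * c * a⁻¹ * c⁻¹ ∈ Subgroup.zpowers (u * v⁻¹))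
    (hμP : ∀ κE : ZpExtension ↥(fixedField (Subgroup.zpowers v)) p, κE.IsCyclotomic → ClassicalMuVanishes κE)
    (hμK : ∀ κE : ZpExtension ↥(fixedField (Subgroup.zpowers (u * v⁻¹) ⊔ Subgroup.zpowers w)) p,
      κE.IsCyclotomic → ClassicalMuVanishes κE)
    (hμQ : ∀ κE : ZpExtension ↥(fixedField (Subgroup.zpowers (u * v⁻¹) ⊔ Subgroup.zpowers (w * u))) p,
      κE.IsCyclotomic → ClassicalMuVanishes κE) :
    ∀ κE : ZpExtension ↥(fixedField (Subgroup.zpowers (u * v⁻¹) ⊔ Subgroup.zpowers (u * u))) p,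
      κE.IsCyclotomic → ClassicalMuVanishes κE := by
  obtain ⟨N, hN⟩ : ∃ N : Subgroup (L ≃ₐ[ℚ] L), N = Subgroup.zpowers (u * v⁻¹) ⊔ Subgroup.zpowers (u * u) := ⟨_, rfl⟩
  have htN : Subgroup.zpowers (u * v⁻¹) ≤ N := hN ▸ le_sup_left
  have huuN : u * u ∈ N := hN ▸ Subgroup.mem_sup_right (Subgroup.mem_zpowers _)
  have hcommN : ∀ a c : L ≃ₐ[ℚ] L, a * c * a⁻¹ * c⁻¹ ∈ N := fun a c => htN (hcomm a c)
  haveI hNN : N.Normal := normal_of_forall_commutator_mem N hcommN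
  rw [← hN]
  -- the quotient `Gal(B/ℚ)`, `B = L^N`
  haveI : IsGalois ℚ ↥(fixedField N) := IsGalois.of_fixedField_normal_subgroup N
  have hp₀ : ¬ p ∣ Module.finrank ℚ ↥(fixedField N) := not_dvd_finrank_intermediateField_rat hp _
  obtain ⟨π, hπ⟩ : ∃ π : (L ≃ₐ[ℚ] L) →* (↥(fixedField N) ≃ₐ[ℚ] ↥(fixedField N)),
      π = AlgEquiv.restrictNormalHom ↥(fixedField N) := ⟨_, rfl⟩
  have hker : ∀ g, π g = 1 ↔ g ∈ N := by
    intro g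
    have h1 := IntermediateField.restrictNormalHom_ker (K := ℚ) (L := L) (fixedField N)
    rw [IntermediateField.fixingSubgroup_fixedField] at h1
    rw [← MonoidHom.mem_ker, hπ]
    exact SetLike.ext_iff.mp h1 g
  have hNπ : N.map π = ⊥ := by
    rw [Subgroup.map_eq_bot_iff]
    intro g hg
    rw [MonoidHom.mem_ker]
    exact (hker g).mpr hg
  -- the Klein four `z̄ = π w`, `b̄ = π u`
  have hz : π w * π w = 1 := by rw [← map_mul, hw2, map_one]
  have hb : π u * π u = 1 := by rw [← map_mul, hker]; exact huuN
  have hzb : π w * π u = π u * π w := by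
    have h1 : π (w * u * w⁻¹ * u⁻¹) = 1 := (hker _).mpr (hcommN w u)
    rw [map_mul, map_mul, map_mul, map_inv, map_inv, mul_inv_eq_one, mul_inv_eq_iff_eq_mul] at h1
    exact h1
  -- (a) `B^{z̄} ≅ L^{N ⊔ ⟨w⟩} ⊆ K′`
  have hmapa : (N ⊔ Subgroup.zpowers w).map π = Subgroup.zpowers (π w) := by
    rw [Subgroup.map_sup, MonoidHom.map_zpowers, hNπ, bot_sup_eq]
  have hlea : Subgroup.zpowers (u * v⁻¹) ⊔ Subgroup.zpowers w ≤ N ⊔ Subgroup.zpowers w := sup_le_sup_right htN _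
  have hμa : ∀ κE : ZpExtension ↥(fixedField (Subgroup.zpowers (π w))) p, κE.IsCyclotomic → ClassicalMuVanishes κE :=
    forall_classicalMuVanishes_fixedField_quotient hp N _ le_sup_left π hπ _ hmapa
      (forall_classicalMuVanishes_fixedField_of_le hp hlea hμK)
  -- (b) `B^{b̄} ≅ L^{N ⊔ ⟨u⟩} ⊆ L^{⟨v⟩}` (`v = (u v⁻¹)⁻¹ u`)
  have hmapb : (N ⊔ Subgroup.zpowers u).map π = Subgroup.zpowers (π u) := by
    rw [Subgroup.map_sup, MonoidHom.map_zpowers, hNπ, bot_sup_eq]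
  have hleb : Subgroup.zpowers v ≤ N ⊔ Subgroup.zpowers u := by
    rw [Subgroup.zpowers_le]
    have h1 : v = (u * v⁻¹)⁻¹ * u := by group
    rw [h1]
    exact (N ⊔ _).mul_mem ((N ⊔ _).inv_mem (Subgroup.mem_sup_left (htN (Subgroup.mem_zpowers _))))
      (Subgroup.mem_sup_right (Subgroup.mem_zpowers _))
  have hμb : ∀ κE : ZpExtension ↥(fixedField (Subgroup.zpowers (π u))) p, κE.IsCyclotomic → ClassicalMuVanishes κE :=
    forall_classicalMuVanishes_fixedField_quotient hp N _ le_sup_left π hπ _ hmapb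
      (forall_classicalMuVanishes_fixedField_of_le hp hleb hμP)
  -- (c) `B^{z̄ b̄} ≅ L^{N ⊔ ⟨wu⟩} ⊆ Q₂`
  have hmapc : (N ⊔ Subgroup.zpowers (w * u)).map π = Subgroup.zpowers (π w * π u) := by
    rw [Subgroup.map_sup, MonoidHom.map_zpowers, hNπ, bot_sup_eq, map_mul]
  have hlec : Subgroup.zpowers (u * v⁻¹) ⊔ Subgroup.zpowers (w * u) ≤ N ⊔ Subgroup.zpowers (w * u) := sup_le_sup_right htN _
  have hμc : ∀ κE : ZpExtension ↥(fixedField (Subgroup.zpowers (π w * π u))) p,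
      κE.IsCyclotomic → ClassicalMuVanishes κE :=
    forall_classicalMuVanishes_fixedField_quotient hp N _ le_sup_left π hπ _ hmapc
      (forall_classicalMuVanishes_fixedField_of_le hp hlec hμQ)
  -- (d) `B^{⟨z̄, b̄⟩} ≅ L^{N ⊔ (⟨w⟩ ⊔ ⟨u⟩)} ⊆ K′`
  have hmapd : (N ⊔ (Subgroup.zpowers w ⊔ Subgroup.zpowers u)).map π = Subgroup.closure {π w, π u} := by
    rw [Subgroup.map_sup, Subgroup.map_sup, MonoidHom.map_zpowers, MonoidHom.map_zpowers, hNπ, bot_sup_eq, Set.insert_eq,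
      Subgroup.closure_union, ← Subgroup.zpowers_eq_closure, ← Subgroup.zpowers_eq_closure]
  have hled : Subgroup.zpowers (u * v⁻¹) ⊔ Subgroup.zpowers w ≤ N ⊔ (Subgroup.zpowers w ⊔ Subgroup.zpowers u) :=
    sup_le (htN.trans le_sup_left) (le_sup_left.trans le_sup_right)
  have hμd : ∀ κE : ZpExtension ↥(fixedField (Subgroup.closure {π w, π u})) p,
      κE.IsCyclotomic → ClassicalMuVanishes κE :=
    forall_classicalMuVanishes_fixedField_quotient hp N _ le_sup_left π hπ _ hmapd
      (forall_classicalMuVanishes_fixedField_of_le hp hled hμK)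
  exact classicalMuVanishes_of_isCyclotomic_of_biquadratic hp2 ↥(fixedField N) hp₀ hz hb hzb hμa hμb hμc hμd

/-! ### §3 The maximal abelian leaf `A = L^{⟨uv⁻¹⟩}` from `B`, `K′`, `Z = L^{⟨uv⁻¹, u²w⟩}` -/

set_option maxHeartbeats 800000 in
/-- **Step (A): `A = L^{⟨uv⁻¹⟩}` (`= L^{[G,G]} = ℚ(ζ₅, √d₁)` for `L = ℚ(E[5])`).**  `L/ℚ` finite Galois, `p` odd, `p ∤ [L:ℚ]`;
`u, w ∈ Gal(L/ℚ)` with `u⁴ = 1`, `w² = 1`, all commutators in `⟨uv⁻¹⟩`.  `N = ⟨uv⁻¹⟩` is normal and `{1, ū², w̄, ū²w̄}` is a Klein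
four in `Gal(L^N/ℚ)` with supports `L^{⟨uv⁻¹,u²⟩} = B`, `L^{⟨uv⁻¹,w⟩} = K′`, `L^{⟨uv⁻¹,u²w⟩} = Z` and `L^{⟨uv⁻¹,u²,w⟩} ⊆ K′`;
Kuroda's equality at every layer.  NO named fact. [cite: Lemmermeyer1994, §1 (Kuroda's class number formula, odd part)]
[cite: Washington1997, §13.1] [cite: MilneFT2022, Ch. 3] [cite: Serre1972, §2.2 (split Cartan subgroups, normalisers)] -/
theorem classicalMuVanishes_of_isCyclotomic_fixedField_comm (hp2 : p ≠ 2) (L : Type) [Field L] [NumberField L]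
    [IsGalois ℚ L] (hp : ¬ p ∣ Module.finrank ℚ L) {u v w : L ≃ₐ[ℚ] L} (hu4 : u * u * (u * u) = 1) (hw2 : w * w = 1)
    (hcomm : ∀ a c : L ≃ₐ[ℚ] L, a * c * a⁻¹ * c⁻¹ ∈ Subgroup.zpowers (u * v⁻¹))
    (hμB : ∀ κE : ZpExtension ↥(fixedField (Subgroup.zpowers (u * v⁻¹) ⊔ Subgroup.zpowers (u * u))) p,
      κE.IsCyclotomic → ClassicalMuVanishes κE)
    (hμK : ∀ κE : ZpExtension ↥(fixedField (Subgroup.zpowers (u * v⁻¹) ⊔ Subgroup.zpowers w)) p,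
      κE.IsCyclotomic → ClassicalMuVanishes κE)
    (hμZ : ∀ κE : ZpExtension ↥(fixedField (Subgroup.zpowers (u * v⁻¹) ⊔ Subgroup.zpowers (u * u * w))) p,
      κE.IsCyclotomic → ClassicalMuVanishes κE) :
    ∀ κE : ZpExtension ↥(fixedField (Subgroup.zpowers (u * v⁻¹))) p, κE.IsCyclotomic → ClassicalMuVanishes κE := by
  obtain ⟨N, hN⟩ : ∃ N : Subgroup (L ≃ₐ[ℚ] L), N = Subgroup.zpowers (u * v⁻¹) := ⟨_, rfl⟩
  have hcommN : ∀ a c : L ≃ₐ[ℚ] L, a * c * a⁻¹ * c⁻¹ ∈ N := fun a c => hN ▸ hcomm a c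
  haveI hNN : N.Normal := normal_of_forall_commutator_mem N hcommN
  rw [← hN]
  haveI : IsGalois ℚ ↥(fixedField N) := IsGalois.of_fixedField_normal_subgroup N
  have hp₀ : ¬ p ∣ Module.finrank ℚ ↥(fixedField N) := not_dvd_finrank_intermediateField_rat hp _
  obtain ⟨π, hπ⟩ : ∃ π : (L ≃ₐ[ℚ] L) →* (↥(fixedField N) ≃ₐ[ℚ] ↥(fixedField N)),
      π = AlgEquiv.restrictNormalHom ↥(fixedField N) := ⟨_, rfl⟩
  have hker : ∀ g, π g = 1 ↔ g ∈ N := by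
    intro g
    have h1 := IntermediateField.restrictNormalHom_ker (K := ℚ) (L := L) (fixedField N)
    rw [IntermediateField.fixingSubgroup_fixedField] at h1
    rw [← MonoidHom.mem_ker, hπ]
    exact SetLike.ext_iff.mp h1 g
  have hNπ : N.map π = ⊥ := by
    rw [Subgroup.map_eq_bot_iff]
    intro g hg
    rw [MonoidHom.mem_ker]
    exact (hker g).mpr hg
  -- the Klein four `z̄ = π(u²)`, `b̄ = π w`
  have hz : π (u * u) * π (u * u) = 1 := by rw [← map_mul, hu4, map_one]
  have hb : π w * π w = 1 := by rw [← map_mul, hw2, map_one]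
  have hzb : π (u * u) * π w = π w * π (u * u) := by
    have h1 : π (u * u * w * (u * u)⁻¹ * w⁻¹) = 1 := (hker _).mpr (hcommN (u * u) w)
    rw [map_mul, map_mul, map_mul, map_inv, map_inv, mul_inv_eq_one, mul_inv_eq_iff_eq_mul] at h1
    exact h1
  -- (a) `A^{z̄} ≅ L^{N ⊔ ⟨u²⟩} = B`
  have hmapa : (N ⊔ Subgroup.zpowers (u * u)).map π = Subgroup.zpowers (π (u * u)) := by
    rw [Subgroup.map_sup, MonoidHom.map_zpowers, hNπ, bot_sup_eq]
  have hμa : ∀ κE : ZpExtension ↥(fixedField (Subgroup.zpowers (π (u * u)))) p,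
      κE.IsCyclotomic → ClassicalMuVanishes κE :=
    forall_classicalMuVanishes_fixedField_quotient hp N _ le_sup_left π hπ _ hmapa
      (forall_classicalMuVanishes_fixedField_of_eq hp (by rw [hN]) hμB)
  -- (b) `A^{b̄} ≅ L^{N ⊔ ⟨w⟩} = K′`
  have hmapb : (N ⊔ Subgroup.zpowers w).map π = Subgroup.zpowers (π w) := by
    rw [Subgroup.map_sup, MonoidHom.map_zpowers, hNπ, bot_sup_eq]
  have hμb : ∀ κE : ZpExtension ↥(fixedField (Subgroup.zpowers (π w))) p, κE.IsCyclotomic → ClassicalMuVanishes κE :=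
    forall_classicalMuVanishes_fixedField_quotient hp N _ le_sup_left π hπ _ hmapb
      (forall_classicalMuVanishes_fixedField_of_eq hp (by rw [hN]) hμK)
  -- (c) `A^{z̄ b̄} ≅ L^{N ⊔ ⟨u²w⟩} = Z`
  have hmapc : (N ⊔ Subgroup.zpowers (u * u * w)).map π = Subgroup.zpowers (π (u * u) * π w) := by
    rw [Subgroup.map_sup, MonoidHom.map_zpowers, hNπ, bot_sup_eq, map_mul]
  have hμc : ∀ κE : ZpExtension ↥(fixedField (Subgroup.zpowers (π (u * u) * π w))) p,
      κE.IsCyclotomic → ClassicalMuVanishes κE :=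
    forall_classicalMuVanishes_fixedField_quotient hp N _ le_sup_left π hπ _ hmapc
      (forall_classicalMuVanishes_fixedField_of_eq hp (by rw [hN]) hμZ)
  -- (d) `A^{⟨z̄, b̄⟩} ≅ L^{N ⊔ (⟨u²⟩ ⊔ ⟨w⟩)} ⊆ K′`
  have hmapd : (N ⊔ (Subgroup.zpowers (u * u) ⊔ Subgroup.zpowers w)).map π = Subgroup.closure {π (u * u), π w} := by
    rw [Subgroup.map_sup, Subgroup.map_sup, MonoidHom.map_zpowers, MonoidHom.map_zpowers, hNπ, bot_sup_eq, Set.insert_eq,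
      Subgroup.closure_union, ← Subgroup.zpowers_eq_closure, ← Subgroup.zpowers_eq_closure]
  have hled : Subgroup.zpowers (u * v⁻¹) ⊔ Subgroup.zpowers w ≤ N ⊔ (Subgroup.zpowers (u * u) ⊔ Subgroup.zpowers w) :=
    sup_le (hN ▸ le_sup_left) (le_sup_right.trans le_sup_right)
  have hμd : ∀ κE : ZpExtension ↥(fixedField (Subgroup.closure {π (u * u), π w})) p,
      κE.IsCyclotomic → ClassicalMuVanishes κE :=
    forall_classicalMuVanishes_fixedField_quotient hp N _ le_sup_left π hπ _ hmapd
      (forall_classicalMuVanishes_fixedField_of_le hp hled hμK)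
  exact classicalMuVanishes_of_isCyclotomic_of_biquadratic hp2 ↥(fixedField N) hp₀ hz hb hzb hμa hμb hμc hμd

end Literature.NumberTheory.IwasawaTheory

end
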